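import Mathlib
import HarnessLib
import Summits.HubbardSuperconductivity.HubbardSuperconductivity.Theorems.KLProgrammeKLRegimeTwoVolumeTowerStep
import Summits.HubbardSuperconductivity.HubbardSuperconductivity.Theorems.KLProgrammeKLRegimeTwoVolumeTowerSpineDefs
import Summits.HubbardSuperconductivity.HubbardSuperconductivity.Theorems.KLProgrammeKLRegimeTwoVolumeTowerSpineKit
import Summits.HubbardSuperconductivity.HubbardSuperconductivity.Theorems.KLProgrammeKLRegimeTwoVolumeStepProfileKit
import Summits.HubbardSuperconductivity.HubbardSuperconductivity.Theorems.KLProgrammeKLRegimeTwoVolumeDefectLimitTower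
import Literature.MathematicalPhysics.QuantumLattice.GrassmannFlowIteration

/-!
# Route `KLProgramme` — crux K3, VL child `KLRegimeVolumeLimitV17F2` (stmt-HubbardSuperconductivity-20440), blueprint v5 M5 / W5: THE STATES OF THE TOWER AND
# ONE STEP OF THE SPINE AT ONE INSTANCE (seat hubbard-kl-k3c4-p1 g13; `--supports` 20440)

Two lemmas between `…TwoVolumeTowerStep` (the model step on the named tower) and `…TwoVolumeTowerSpine` (the limit spine over all instances):

* **`towerState_parity_profile`** — from the own-frame data `TowerVolumeData V … K J ε …` of ONE volume and the volume-free smallness of the scales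
  (`ν₀ j`, `θ₀ j < 1`): every state `klTowerState V … K j`, `j ≤ J`, is even without constant part and has the raw `Λ (j−1)`-weighted profile `ε · NS j`
  (`NS 0 = [even]·NV 0 (·/2)` by parity; `NS (j+1) k = ρ₀_j^{−k} e ν₀_j / (1 − θ₀_j)` by ONE weighted determinant-bounded step `…StepProfileKit`);
* `klKeyedDefect_le_of_wtProfileRaw` — the everywhere bound of the keyed defect by the two raw profiles;
* **`tower_keyedDefect_succ_le`** — ONE STEP OF THE SPINE AT ONE INSTANCE `(L, b, M)`: given the three data bundles (`TowerVolumeData` of both volumes at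
  their own frames, `TowerCrossData`), `TowerScaleSmall` of scale `j`, the states' parity/profiles, the mismatch numbers of this `L`, the depth schedule
  `(D₀, r)` with `2r ≤ D₀`, and ANY majorant `Ej ≤ 2·NS j` of the keyed defects of step `j` at the `D₀`-deep pins, the keyed defect of step `j+1` at a
  `(D₀+2r)`-deep pin in degree `n+1` is at most `ε ×` the spine's linear form `KE·Σ' + KD·(1+Λ_j(r+1))⁻¹ + KTe·Te + KT·T + KRf·(Λ_j(r+1))⁻¹` with the
  volume-free coefficients of `…TowerStep` (series majorant `Σ'_m (e²(κ′+ρ′))^{2m}·tb(m)` of the field-weighted norm by `normV_le_tsum_of_le`).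

Proofs only; no definition.
-/

noncomputable section

namespace Summit.HubbardSuperconductivity.HubbardSuperconductivity.Theorems.TwoVolumeSource

set_option linter.dupNamespace false -- summit = problem name (single-conjunct summit), D-0017

open Finset Literature.MathematicalPhysics.QuantumLattice GrassmannAlgebra Literature.Probability.LatticeModels
  Literature.Probability.LatticeModels.BattleFederbush
open Summit.HubbardSuperconductivity.HubbardSuperconductivity.Theorems.TwoPointAssembly
open Summit.HubbardSuperconductivity.HubbardSuperconductivity.Theorems.KLRegimeSplit
open Summit.HubbardSuperconductivity.HubbardSuperconductivity.Theorems.KLProgrammeLegKernels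
open Summit.HubbardSuperconductivity.HubbardSuperconductivity.Theorems.EngineV8
open Summit.HubbardSuperconductivity.HubbardSuperconductivity.Theorems.TwoVolumeDefect

/-! ## §1 The states: parity and raw profiles -/

/-- **Every state of the tower is even without constant part and carries the raw weighted profile `ε · NS j`** (see the module docstring).
[cite: BenfattoGiulianiMastropietro2006, (2.15), (2.77)-(2.80)] -/
theorem towerState_parity_profile {V M : ℕ} [NeZero V] (β U μ : ℝ) (K : TrigPolyC4v) (J : ℕ) {ε : ℝ} (hε : 0 < ε)
    (Λ κ aW sW ρ₀ ν₀ : ℕ → ℝ) (NV NS : ℕ → ℕ → ℝ) (hd : TowerVolumeData V M β U μ K J ε Λ κ aW sW NV)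
    (hΛ : ∀ j, 0 < Λ j) (hρ₀ : ∀ j, 0 < ρ₀ j) (hNV0 : ∀ j m, 0 ≤ NV j m)
    (hν₀ : ∀ j, j < J → HasSum (fun m => (Real.exp 2 * (κ j + ρ₀ j)) ^ (2 * m) * NV j m) (ν₀ j))
    (hθ₀ : ∀ j, j < J → Real.exp 1 * aW j * ν₀ j / κ j ^ 2 < 1)
    (hNS0 : ∀ k, NS 0 k = if Even k then NV 0 (k / 2) else 0)
    (hNSsucc : ∀ j k, j < J → NS (j + 1) k = (ρ₀ j)⁻¹ ^ k * (Real.exp 1 * ν₀ j) / (1 - Real.exp 1 * aW j * ν₀ j / κ j ^ 2))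
    (j : ℕ) (hj : j ≤ J) :
    klTowerState V M β U μ K j ∈ evenOdd ℂ 0 ∧ constPart ℂ (klTowerState V M β U μ K j) = 0 ∧
      WtProfileRaw (klTowerState V M β U μ K j) (Λ (j - 1)) (fun k => ε * NS j k) := by
  cases j with
  | zero =>
    obtain ⟨he, h0⟩ := hd.parity 0 (Nat.zero_le _)
    refine ⟨he, h0, (wtProfileRaw_of_wtProfileEven he (hd.profile 0 (Nat.zero_le _))).mono fun k => ?_⟩
    rw [hNS0]
    split_ifs
    · exact le_rfl
    · simp
  | succ k' =>
    have hk' : k' < J := hj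
    have hρk : 0 < ρ₀ k' := hρ₀ k'
    letI : LinearOrder (SrcLabel V M k') := LinearOrder.lift' (Fintype.equivFin (SrcLabel V M k')) (Fintype.equivFin _).injective
    obtain ⟨he, h0⟩ := hd.parity k' hk'.le
    have hcov := hd.cov k' hk'
    have hκ := hcov.κ_pos
    have haW : 0 < aW k' := by have h := mul_pos hcov.αW_pos hε; rwa [div_mul_cancel₀ _ hε.ne'] at h
    set X : ℝ := normV (SrcLabel V M k') (κ k') (ρ₀ k') (NV k') with hXdef
    have hX0 : 0 ≤ X := normV_nonneg hκ.le (hρ₀ k').le (hNV0 k')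
    have hXν : X ≤ ν₀ k' := normV_le_of_hasSum hκ.le (hρ₀ k').le (hNV0 k') (hν₀ k' hk')
    have hXε : normV (SrcLabel V M k') (κ k') (ρ₀ k') (fun m => ε * NV k' m) = ε * X := normV_const_mul _ _ _ _
    have hprod : Real.exp 1 * (aW k' / ε) * (ε * X) = Real.exp 1 * aW k' * X := by field_simp
    have hθle : Real.exp 1 * aW k' * X / κ k' ^ 2 ≤ Real.exp 1 * aW k' * ν₀ k' / κ k' ^ 2 := by gcongr
    have hθX : Real.exp 1 * aW k' * X / κ k' ^ 2 < 1 := hθle.trans_lt (hθ₀ k' hk')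
    have hθ : Real.exp 1 * (aW k' / ε) * normV (SrcLabel V M k') (κ k') (ρ₀ k') (fun m => ε * NV k' m) / κ k' ^ 2 < 1 := by
      rw [hXε, hprod]; exact hθX
    obtain ⟨hZ, hprof⟩ := wtProfileRaw_effAction_of_wtProfileEven (klStepCov V M β μ K k') (klStepCovD V M β μ K k') (klStepCovD_apply β μ K k')
      (hΛ k').le hcov (klTowerD V M β U μ K k') he h0 (hd.profile k' hk'.le) (hρ₀ k') hθ
    refine ⟨(mem_evenPart_iff).1 (effAction_mem_evenPart _ ((mem_evenPart_iff).2 he) h0), constPart_effAction ℂ _ _ hZ, hprof.mono fun k => ?_⟩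
    rw [hNSsucc k' k hk', hXε, hprod]
    have hid : (ρ₀ k')⁻¹ ^ k * (Real.exp 1 * (ε * X)) / (1 - Real.exp 1 * aW k' * X / κ k' ^ 2) =
        ε * ((ρ₀ k')⁻¹ ^ k * (Real.exp 1 * X) / (1 - Real.exp 1 * aW k' * X / κ k' ^ 2)) := by ring
    rw [hid]
    exact mul_le_mul_of_nonneg_left (div_one_sub_mono (by positivity) (by gcongr) hθle (hθ₀ k' hk')) hε.le

/-! ## §2 The everywhere bound of the keyed defect -/

/-- **The keyed defect is below the two raw profiles** (fine at the pin, coarse at its residue). [folklore] -/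
theorem klKeyedDefect_le_of_wtProfileRaw {L b M : ℕ} [NeZero L] [NeZero (b * L)] (β U μ : ℝ) (Kc Kf : TrigPolyC4v) (j : ℕ)
    {Λ' Λ : ℝ} {N' N : ℕ → ℝ} (h' : WtProfileRaw (klTowerState (b * L) M β U μ Kf j) Λ' N') (h : WtProfileRaw (klTowerState L M β U μ Kc j) Λ N)
    (k : ℕ) (p : Fin k) (w : SrcLabel (b * L) M (j - 1)) :
    klKeyedDefect L b M β U μ Kc Kf j k p w ≤ N' k + N k := by
  rw [klKeyedDefect_eq]
  exact sum_filter_norm_keyedGlued_le_of_wtProfileRaw (klBlockEquivD L b M (j - 1)) h' h k p w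

/-! ## §3 One step of the spine at one instance -/

set_option maxHeartbeats 800000 in -- one ~150-binder instantiation plus the series bookkeeping
/-- **ONE STEP OF THE SPINE AT ONE INSTANCE** (see the module docstring). [folklore: instantiation; cite: BenfattoGiulianiMastropietro2006, §2.7-§2.9 and §3] -/
theorem tower_keyedDefect_succ_le {L b M : ℕ} [NeZero L] [NeZero (b * L)] [NeZero M] (β U μ : ℝ) (hβ : β ≠ 0) (Kc Kf : TrigPolyC4v) (J j : ℕ)
    (hj : j < J) {ε : ℝ} (hε : 0 < ε) (Λ κ aW sW κ' aW' sW' eW' ΛT cW κf sE cR cC δ : ℕ → ℝ) (NV NS : ℕ → ℕ → ℝ)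
    (hdL : TowerVolumeData L M β U μ Kc J ε Λ κ aW sW NV) (hdF : TowerVolumeData (b * L) M β U μ Kf J ε Λ κ aW sW NV)
    (hX : TowerCrossData L b M β μ Kc Kf J ε Λ κ' aW' sW' eW' ΛT cW κf sE cR cC δ)
    {cRb cCb δb ρ₀ ρf ρ₂ ρ' ρ₃ ν₀ ν₁ ν₂ ν₃ ν₄ ν₅ νE ν₆ ν₇ ν₈ : ℝ}
    (hsm : TowerScaleSmall (κ j) (κ' j) (aW j) (aW' j) (cW j) (κf j) cRb cCb δb ρ₀ ρf ρ₂ ρ' ρ₃ (NV j) (NS j) ν₀ ν₁ ν₂ ν₃ ν₄ ν₅ νE ν₆ ν₇ ν₈)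
    (hΛ : ∀ j, 0 < Λ j) (hΛmono : Λ j ≤ Λ (j - 1)) (hΛT : Λ j ≤ ΛT j) (hκf : 0 < κf j)
    (hρ₀ : 0 < ρ₀) (hρf : 0 < ρf) (hρ₂ : 0 < ρ₂) (hρ' : 0 < ρ') (hρ₃ : 0 < ρ₃) (hδb : 0 ≤ δb)
    (hNV0 : ∀ j m, 0 ≤ NV j m) (hNSj0 : ∀ k, 0 ≤ NS j k)
    -- the two states of step `j`: parity and raw profiles (from `towerState_parity_profile` on each volume)
    (hSc : klTowerState L M β U μ Kc j ∈ evenOdd ℂ 0 ∧ constPart ℂ (klTowerState L M β U μ Kc j) = 0 ∧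
      WtProfileRaw (klTowerState L M β U μ Kc j) (Λ (j - 1)) (fun k => ε * NS j k))
    (hSf : klTowerState (b * L) M β U μ Kf j ∈ evenOdd ℂ 0 ∧ constPart ℂ (klTowerState (b * L) M β U μ Kf j) = 0 ∧
      WtProfileRaw (klTowerState (b * L) M β U μ Kf j) (Λ (j - 1)) (fun k => ε * NS j k))
    -- the mismatch numbers of this volume pair: signs and volume-free caps
    (hsE0 : 0 ≤ sE j) (hcR : 0 ≤ cR j) (hcC : 0 ≤ cC j) (hcRb : cR j ≤ cRb) (hcCb : cC j ≤ cCb) (hδ0 : 0 ≤ δ j) (hδle : δ j ≤ δb)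
    -- the depth schedule: the step-`j` defects are controlled at the `D₀`-deep pins, the output pin is `(D₀ + 2r)`-deep
    (D₀ r : ℕ) (hD₀ : 2 * r ≤ D₀)
    -- the scale-`j` majorant
    (Ej : ℕ → ℝ) (hEj0 : ∀ k, 0 ≤ Ej k) (hEjb : ∀ k, Ej k ≤ NS j k + NS j k)
    (hEj : ∀ (k : ℕ) (p' : Fin k) (y' : SrcLabel (b * L) M (j - 1)), (∀ i, D₀ ≤ (y'.1.1.2 i).val % L ∧ (y'.1.1.2 i).val % L + D₀ < L) →
      klKeyedDefect L b M β U μ Kc Kf j k p' y' ≤ ε * Ej k)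
    (n : ℕ) (p : Fin (n + 1)) (w : SrcLabel (b * L) M j) (hw : ∀ i, D₀ + 2 * r ≤ (w.1.1.2 i).val % L ∧ (w.1.1.2 i).val % L + (D₀ + 2 * r) < L) :
    klKeyedDefect L b M β U μ Kc Kf (j + 1) (n + 1) p w ≤
      ε * (((ρ'⁻¹ ^ (n + 1) * Real.exp 1 / (1 - Real.exp 1 * aW' j * (ν₁ + νE) / κ' j ^ 2) ^ 2)) *
          (∑' m : ℕ, (Real.exp 2 * (κ' j + ρ')) ^ (2 * m) *
            (cW j ^ (2 * m - 1) * (cW j * Ej (2 * m) + cW j / (1 + ΛT j * ((r : ℝ) + 1)) * (NS j (2 * m) + NS j (2 * m))) +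
              (2 * cW j ^ (2 * m - 1) * (cW j / (1 + ΛT j * ((r : ℝ) + 1))) * NS j (2 * m) +
                ((2 * m - 1 : ℕ) : ℝ) * cW j ^ (2 * m - 1) *
                  (5 * (cW j / (1 + ΛT j * ((r : ℝ) + 1))) * NS j (2 * m) + 2 * cW j * ((1 + Λ (j - 1) * ((r : ℝ) + 1))⁻¹ * NS j (2 * m)))))) +
        ((ρ'⁻¹ ^ (n + 1) * (Real.exp 1 * ν₂) / (1 - Real.exp 1 * aW' j * (ν₃ + ν₂) / κ' j ^ 2) ^ 2)) * (1 + Λ j * ((r : ℝ) + 1))⁻¹ +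
        ((((((n + 1 + 1) * (n + 1 + 2) : ℕ) : ℝ) / 2 *
            (ρ₂⁻¹ ^ (n + 3) * (Real.exp 1 * ν₄) / (1 - Real.exp 1 * (aW' j + aW j + (aW' j + aW j)) * ν₄ / (κ' j + κ j + (κ' j + κ j + (κ' j + κ j))) ^ 2)))) +
          (((((n + 1 + 1) * (n + 1 + 2) : ℕ) : ℝ) / 2 * (ρ₃⁻¹ ^ (n + 3) * (Real.exp 1 * ν₆) / (1 - Real.exp 1 * (aW' j + (cRb + cCb)) * ν₆ / κf j ^ 2))) +
           (‖(2 : ℂ)⁻¹‖ * ∑ a' ∈ range (n + 2), ∑ b' ∈ range (n + 2),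
          (if a' + b' = n + 1 then (((a' + 1) * (b' + 1) : ℕ) : ℝ) *
            ((ρ₃⁻¹ ^ (a' + 1) * (Real.exp 1 * ν₆) / (1 - Real.exp 1 * (aW' j + (cRb + cCb)) * ν₆ / κf j ^ 2)) *
              (ρ₃⁻¹ ^ (b' + 1) * (Real.exp 1 * ν₆) / (1 - Real.exp 1 * (aW' j + (cRb + cCb)) * ν₆ / κf j ^ 2))) else 0)) +
           (ρ₃⁻¹ ^ (n + 1) * (Real.exp 1 * ν₈) / (1 - Real.exp 1 * aW' j * (ν₇ + δb * ν₈) / κf j ^ 2) ^ 2))) *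
            (eW' j / (1 + Λ j * (((D₀ + r : ℕ) : ℝ) + 1)) + (sE j + (cR j + cC j) + δ j)) +
        ((‖(2 : ℂ)⁻¹‖ * ∑ a ∈ range (n + 2), ∑ b ∈ range (n + 2),
            (if a + b = n + 1 then (((a + 1) * (b + 1) : ℕ) : ℝ) *
              (4 * (ρ₂⁻¹ ^ (a + 1) * (Real.exp 1 * ν₄) / (1 - Real.exp 1 * (aW' j + aW j + (aW' j + aW j)) * ν₄ / (κ' j + κ j + (κ' j + κ j + (κ' j + κ j))) ^ 2)) *
                (ρ₂⁻¹ ^ (b + 1) * (Real.exp 1 * ν₄) / (1 - Real.exp 1 * (aW' j + aW j + (aW' j + aW j)) * ν₄ / (κ' j + κ j + (κ' j + κ j + (κ' j + κ j))) ^ 2))) else 0))) *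
            (aW' j / (1 + Λ j * (((D₀ + r : ℕ) : ℝ) + 1))) +
        (((((n + 1 + 1) * (n + 1 + 2) : ℕ) : ℝ) / 2 * (sW' j + sW j) *
              (ρf⁻¹ ^ (n + 3) * (Real.exp 1 * ν₅) / (1 - Real.exp 1 * (aW' j + aW j + (aW' j + aW j)) * ν₅ / (κ' j + κ j) ^ 2)) +
            ‖(2 : ℂ)⁻¹‖ * ∑ a ∈ range (n + 2), ∑ b ∈ range (n + 2),
              (if a + b = n + 1 then (((a + 1) * (b + 1) : ℕ) : ℝ) *
                (2 * (aW' j + aW j) * (ρf⁻¹ ^ (a + 1) * (Real.exp 1 * ν₅) / (1 - Real.exp 1 * (aW' j + aW j + (aW' j + aW j)) * ν₅ / (κ' j + κ j) ^ 2)) *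
                  (ρf⁻¹ ^ (b + 1) * (Real.exp 1 * ν₅) / (1 - Real.exp 1 * (aW' j + aW j + (aW' j + aW j)) * ν₅ / (κ' j + κ j) ^ 2))) else 0))) *
            (Λ j * ((r : ℝ) + 1))⁻¹) := by
  -- §0 signs
  have hcovL := hdL.cov j hj
  have hcovX := hX.cov j hj
  have htr := hX.transfer j hj.le
  have hκ := hcovL.κ_pos
  have hκ' := hcovX.κ_pos
  have hcW := htr.cW_nonneg
  have hΛT0 := htr.ΛT_nonneg
  have hΛ₁ : 0 ≤ Λ (j - 1) := (hΛ (j - 1)).le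
  have hw' : ∀ i, D₀ + r + r ≤ (w.1.1.2 i).val % L ∧ (w.1.1.2 i).val % L + (D₀ + r + r) < L := fun i => by
    have h := hw i; constructor <;> omega
  -- §1 the scale-`j` two-volume data in keyed form: deep `ε·Ej` near the `(D₀ + r)`-deep legs, everywhere `ε·(NS j + NS j)`
  have hKD : KeyedDefectData (N := sectorCount j) (klBlockEquivD L b M (j - 1)) (klTowerState (b * L) M β U μ Kf j) (klTowerState L M β U μ Kc j)
      (D₀ + r) r (fun k => ε * Ej k) (fun k => ε * (NS j k + NS j k)) := by
    refine ⟨fun k => mul_nonneg hε.le (hEj0 k), fun k => mul_nonneg hε.le (add_nonneg (hNSj0 k) (hNSj0 k)), fun x hx k p' y' hy' => ?_,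
      fun k p' y' => ?_⟩
    · have hdeep := deepRes_of_tnorm_le (b := b) (m := L) (Mf := b * L) rfl hx hy'
      have h := hEj k p' y' hdeep
      rw [klKeyedDefect_eq] at h
      exact h
    · rw [mul_add]
      have h := klKeyedDefect_le_of_wtProfileRaw β U μ Kc Kf j hSf.2.2 hSc.2.2 k p' y'
      rw [klKeyedDefect_eq] at h
      exact h
  -- §2 the transfer majorant `Ein = tb` and its field-weighted norm below the series
  set Ein : ℕ → ℝ := fun m => cW j ^ (2 * m - 1) * (cW j * Ej (2 * m) + cW j / (1 + ΛT j * ((r : ℝ) + 1)) * (NS j (2 * m) + NS j (2 * m))) +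
      (2 * cW j ^ (2 * m - 1) * (cW j / (1 + ΛT j * ((r : ℝ) + 1))) * NS j (2 * m) +
        ((2 * m - 1 : ℕ) : ℝ) * cW j ^ (2 * m - 1) *
          (5 * (cW j / (1 + ΛT j * ((r : ℝ) + 1))) * NS j (2 * m) + 2 * cW j * ((1 + Λ (j - 1) * ((r : ℝ) + 1))⁻¹ * NS j (2 * m)))) with hEin
  have hτ0 : 0 ≤ cW j / (1 + ΛT j * ((r : ℝ) + 1)) := by positivity
  have hτle : cW j / (1 + ΛT j * ((r : ℝ) + 1)) ≤ cW j := div_le_self hcW (le_add_of_nonneg_right (by positivity))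
  have hNf0 : ∀ m, 0 ≤ (1 + Λ (j - 1) * ((r : ℝ) + 1))⁻¹ * NS j m := fun m => mul_nonneg (inv_nonneg.2 (by positivity)) (hNSj0 m)
  have hNfle : ∀ m, (1 + Λ (j - 1) * ((r : ℝ) + 1))⁻¹ * NS j m ≤ NS j m := fun m =>
    (mul_le_mul_of_nonneg_right (inv_le_one_of_one_le₀ (le_add_of_nonneg_right (by positivity))) (hNSj0 m)).trans (le_of_eq (one_mul _))
  have hEin0 : ∀ m, 0 ≤ Ein m := fun m =>
    transferBound_nonneg (2 * m - 1) hcW (hNSj0 _) (add_nonneg (hNSj0 _) (hNSj0 _)) (hEj0 _) hτ0 (hNf0 _)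
  have hEinle : ∀ m, Ein m ≤ cW j ^ (2 * m - 1) * (cW j * (2 * NS j (2 * m)) + cW j * (2 * NS j (2 * m))) +
      (2 * cW j ^ (2 * m - 1) * cW j * NS j (2 * m) + ((2 * m - 1 : ℕ) : ℝ) * cW j ^ (2 * m - 1) * (5 * cW j * NS j (2 * m) + 2 * cW j * NS j (2 * m))) := by
    intro m
    have h := transferBound_le_of_le (2 * m - 1) hcW (hNSj0 (2 * m)) (add_nonneg (hNSj0 (2 * m)) (hNSj0 (2 * m))) ((hEjb (2 * m)).trans (le_of_eq (two_mul _).symm))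
      hτle (hNfle (2 * m))
    refine le_trans h (le_of_eq ?_)
    ring
  have hνE' : normV (SrcLabel (b * L) M j) (κ' j) ρ' Ein ≤ νE := by
    rw [← hsm.hνE.tsum_eq]
    exact normV_le_tsum_of_le hκ'.le hρ'.le hEin0 hEinle hsm.hνE.summable
  have hEin_tsum : normV (SrcLabel (b * L) M j) (κ' j) ρ' Ein ≤ ∑' m : ℕ, (Real.exp 2 * (κ' j + ρ')) ^ (2 * m) * Ein m :=
    normV_le_tsum_of_le hκ'.le hρ'.le hEin0 (fun m => le_rfl)
      (Summable.of_nonneg_of_le (fun m => mul_nonneg (normVWeight_nonneg _ _ hκ'.le hρ'.le m) (hEin0 m))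
        (fun m => mul_le_mul_of_nonneg_left (hEinle m) (normVWeight_nonneg _ _ hκ'.le hρ'.le m)) hsm.hνE.summable)
  -- §3 the field-weighted norms below the named series
  have hθ₀' : 0 < 1 - Real.exp 1 * aW j * ν₀ / κ j ^ 2 := sub_pos.2 hsm.hθ₀
  have hν₀0 : 0 ≤ ν₀ := hsm.hν₀.nonneg_of_nonneg fun m => mul_nonneg (normVWeight_nonneg _ _ hκ.le hρ₀.le m) (hNV0 j m)
  have hNw0 : ∀ m, 0 ≤ ρ₀⁻¹ ^ (2 * m) * (Real.exp 1 * ν₀) / (1 - Real.exp 1 * aW j * ν₀ / κ j ^ 2) := fun m => by positivity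
  have hν₀' : normV (SrcLabel L M j) (κ j) ρ₀ (NV j) ≤ ν₀ := normV_le_of_hasSum hκ.le hρ₀.le (hNV0 j) hsm.hν₀
  have hν₅' : normV (SrcLabel (b * L) M j) (κ' j + κ j) ρf (fun m => ρ₀⁻¹ ^ (2 * m) * (Real.exp 1 * ν₀) / (1 - Real.exp 1 * aW j * ν₀ / κ j ^ 2)) ≤ ν₅ :=
    normV_le_of_hasSum (by positivity) hρf.le hNw0 hsm.hν₅
  have hν₄' : normV (SrcLabel (b * L) M j) (κ' j + κ j + (κ' j + κ j + (κ' j + κ j))) ρ₂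
      (fun m => ρ₀⁻¹ ^ (2 * m) * (Real.exp 1 * ν₀) / (1 - Real.exp 1 * aW j * ν₀ / κ j ^ 2)) ≤ ν₄ :=
    normV_le_of_hasSum (by positivity) hρ₂.le hNw0 hsm.hν₄
  have hNW0 : ∀ m, 0 ≤ cW j ^ (2 * m - 1) * (cW j * NS j (2 * m)) := fun m => mul_nonneg (pow_nonneg hcW _) (mul_nonneg hcW (hNSj0 _))
  have hν₁' : normV (SrcLabel (b * L) M j) (κ' j) ρ' (fun m => NV j m + (cW j ^ (2 * m - 1) * (cW j * NS j (2 * m)) + NV j m)) ≤ ν₁ :=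
    normV_le_of_hasSum hκ'.le hρ'.le (fun m => add_nonneg (hNV0 j m) (add_nonneg (hNW0 m) (hNV0 j m))) hsm.hν₁
  have hν₂' : normV (SrcLabel (b * L) M j) (κ' j) ρ' (fun m => cW j ^ (2 * m - 1) * (cW j * NS j (2 * m)) + NV j m) ≤ ν₂ :=
    normV_le_of_hasSum hκ'.le hρ'.le (fun m => add_nonneg (hNW0 m) (hNV0 j m)) hsm.hν₂
  have hν₃' : normV (SrcLabel (b * L) M j) (κ' j) ρ' (NV j) ≤ ν₃ := normV_le_of_hasSum hκ'.le hρ'.le (hNV0 j) hsm.hν₃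
  have hcδ : 0 ≤ cW j + δb := add_nonneg hcW hδb
  have hν₆' : normV (SrcLabel (b * L) M j) (κf j) ρ₃
      (fun m => cW j ^ (2 * m - 1) * (cW j * NS j (2 * m)) + (2 * m : ℕ) * (cW j + δb) ^ (2 * m - 1) * δb * NS j (2 * m)) ≤ ν₆ :=
    normV_le_of_hasSum hκf.le hρ₃.le (fun m => add_nonneg (hNW0 m) (mul_nonneg (mul_nonneg (mul_nonneg (by positivity) (pow_nonneg hcδ _)) hδb) (hNSj0 _))) hsm.hν₆
  have hν₇' : normV (SrcLabel (b * L) M j) (κf j) ρ₃ (fun m => cW j ^ (2 * m - 1) * (cW j * NS j (2 * m))) ≤ ν₇ :=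
    normV_le_of_hasSum hκf.le hρ₃.le hNW0 hsm.hν₇
  have hν₈' : normV (SrcLabel (b * L) M j) (κf j) ρ₃ (fun m => (2 * m : ℕ) * (cW j + δb) ^ (2 * m - 1) * NS j (2 * m)) ≤ ν₈ :=
    normV_le_of_hasSum hκf.le hρ₃.le (fun m => mul_nonneg (mul_nonneg (by positivity) (pow_nonneg hcδ _)) (hNSj0 _)) hsm.hν₈
  -- §4 the model step on the named tower
  have hst := tower_twoVolume_scaleSucc_le_eps_mul_linear U μ Kc Kf j (rfl : b * L = b * L) hβ (hΛ j)
    (fun k hk => hdL.Z k (by omega)) (fun k hk => hdF.Z k (by omega))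
    (klBlockEquiv L b M (sectorCount j)) (klBlockEquiv_val L b M _) (klBlockEquiv_snd L b M _) (klBlockEquivD L b M j) (klBlockEquivD_apply L b M j)
    (klBlockEquiv L b M (sectorCount (j - 1))) (klBlockEquiv_val L b M _) (klBlockEquiv_snd L b M _) (klBlockEquivD L b M (j - 1))
    (klBlockEquivD_apply L b M (j - 1))
    (D₀ + r) r r (2 * r) r r (by omega) le_rfl le_rfl (by omega) w hw' hε
    hcovL hcovX (hX.sec j hj) htr hSc.1 hSc.2.1 hSf.1 hSf.2.1 hΛ₁ hΛT hΛmono (NS j) (NV j) (NS j) (hNV0 j) hNSj0 hSc.2.2 (hdL.profile j hj.le) hSf.2.2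
    Ej (fun k => NS j k + NS j k) hKD Ein hEin0 ?_
    hκf (hX.gramPath j hj) hsE0 (hX.entry j hj) hcR hcC hcRb hcCb (hX.row j hj) (hX.col j hj) hδ0 hδle (hX.trow j hj.le) (hX.tcol j hj.le)
    hρ₀ hρf hρ₂ hρ' hρ₃ hν₀' hsm.hθ₀ (fun m => ρ₀⁻¹ ^ (2 * m) * (Real.exp 1 * ν₀) / (1 - Real.exp 1 * aW j * ν₀ / κ j ^ 2)) (fun m => rfl)
    hν₅' hsm.hθw hν₄' hsm.hθ₂ (fun m => cW j ^ (2 * m - 1) * (cW j * NS j (2 * m))) (fun m => rfl) hν₁' hν₂' hν₃' hνE' hsm.hbar hsm.hθ₂'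
    hν₆' hν₇' hν₈' hsm.hθf₁ hsm.hθf₂ n p
  swap
  · -- the transfer majorant is `Ein` at `n = 2m′ − 1`
    intro m' hm' n' hn'
    obtain rfl : n' = 2 * m' - 1 := by omega
    have h1 : 2 * m' - 1 + 1 = 2 * m' := by omega
    have h2 : 2 * r - r = r := by omega
    rw [h1, h2]
  -- §5 read the conclusion on the keyed defect and open the series
  refine le_trans (le_of_eq (klKeyedDefect_eq β U μ Kc Kf (j + 1) (n + 1) p w)) (hst.trans (mul_le_mul_of_nonneg_left ?_ hε.le))
  have hKE0 : 0 ≤ ρ'⁻¹ ^ (n + 1) * Real.exp 1 / (1 - Real.exp 1 * aW' j * (ν₁ + νE) / κ' j ^ 2) ^ 2 := div_nonneg (by positivity) (sq_nonneg _)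
  simp only [hEin] at hEin_tsum
  linarith [mul_le_mul_of_nonneg_left hEin_tsum hKE0]

end Summit.HubbardSuperconductivity.HubbardSuperconductivity.Theorems.TwoVolumeSource

end
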